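import Summits.ResolutionOfSingularities.ResolutionOfSingularities.Theorems.FrobeniusClosingPatchingRelPerfectOfAtomDimFour
import Summits.ResolutionOfSingularities.ResolutionOfSingularities.Theorems.FrobeniusClosingPatchingRelPerfectCJSBlowupFormat
import Summits.ResolutionOfSingularities.ResolutionOfSingularities.Theorems.PatchingRelPerfect.Negative.PunctualAtom
import HarnessLib

/-!
# Crux `PatchingRelPerfect` (stmt-ResolutionOfSingularities-16161), line `closed-point-slice`:
# the OPEN CORE `stub_atomDimFour` PINNED to a printed-shaped statement (chain w52, task W1)

[OURS · L1 W5.2 · W1] The registered open stub `stub_atomDimFour` (skeleton sha `d8599e35`) asks,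
for `S` complete regular local of dimension `4` and characteristic `p` with perfect residue field
and `T` integral, proper and birational over `Spec S`, regular off the closed fibre, for a
NON-ZERO ideal sheaf `J` on `T` cosupported in the closed fibre whose blowing up has regular
source.  This file proves that the conclusion follows from **`Scheme.AdmitsDesingularization T`**
— Temkin 2008, Def. 2.2.6: ONE blowing up of `T` along an ideal sheaf cosupported in `Sing T`
with regular source, i.e. exactly the FORMAT of Cossart–Jannsen–Saito 2020, Thm. 1.2 (a finite
sequence of blow-ups in singular centres collapses to this format on Noetherian schemes:
`admitsDesingularization_of_isSingularBlowupSequence`, landed in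
`FrobeniusClosingPatchingRelPerfectCJSBlowupFormat.lean`).  The argument is elementary: the
off-fibre hypothesis puts `Sing T` inside the closed fibre, and the centre is non-zero because the
generic point of the integral scheme `T` is regular (tree lemma `genericPoint_mem_regularLocus`).

Consequences recorded here (all CONDITIONAL on the same open input; the item stays open):
* `atomConclusion_of_admitsDesingularization` — the general pin (any local base, any `T` with a
  regular point);
* `atomDimFour_of_admitsDesingularization` — the registered atom's conclusion for ONE `T` from
  `Scheme.AdmitsDesingularization T`;
* `atomDimFour_of_admitsDesingSandwichedFourPerfect` — the atom hypothesis `hA4` of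
  `Theorems.patchingRelPerfect_of_printed_of_atomDimFour_of_dimGeFive` (p171172) from
  "CJS-format desingularization of sandwiched fourfold germs at perfect closed points";
* `patchingRelPerfect_of_printed_of_admitsDesingFour_of_dimGeFive` — hence the crux
  `FrobeniusClosing.PatchingRelPerfect` BY NAME from the printed dimension-`≤ 3` theorems, that
  desingularization statement, and the dimension-`≥ 5` residual.  Compared with
  `atomDimFour_of_strongResolution_of_axiom4` (p171751) NO principalization / Axiom 4 on regular
  fourfolds is needed: the blow-up FORMAT with singular centre is what the atom consumes.

Nothing here is a statement of the manuscript under review; `AdmitsDesingularization` of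
sandwiched fourfold germs in characteristic `p` is OPEN (Cossart–Piltant arXiv:1412.0868 p. 58
§5; Piltant 2013 p. 2) — this file only fixes its typed shape.

## References

* M. Temkin, Adv. Math. 219 (2008), Def. 2.2.6, Lemma 2.1.4. [Temkin2008]
* V. Cossart, U. Jannsen, S. Saito, LNM 2270 (2020), Thm. 1.2. [CossartJannsenSaito2020]
* V. Cossart, O. Piltant, J. Algebra 529 (2019), Thm. 1.1, Prop. 4.4; arXiv:1412.0868 §5.
  [CossartPiltant2019]
* O. Piltant, RACSAM 107 (2013), p. 2. [Piltant2013]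
-/

-- `Summit.<Summit>.<Sub>.Theorems` with `Sub = Summit` (single-conjunct summit, D-0017)
set_option linter.dupNamespace false

noncomputable section

open CategoryTheory AlgebraicGeometry Literature.AlgebraicGeometry.Resolution

namespace Summit.ResolutionOfSingularities.ResolutionOfSingularities.Theorems

universe u

/-- **The pin, general form.** Let `T → Spec S` be a scheme over a local base which is regular
off the closed fibre and has at least one regular point. If `T` admits a desingularization in
Temkin's sense (Def. 2.2.6: a blowing up along an ideal sheaf cosupported in `Sing T`, with
regular source), then the conclusion of the atom `stub_atomDimFour` holds for `T`: a NON-ZERO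
ideal sheaf cosupported in the closed fibre whose blowing up has regular source (the same
blowing up: its centre lies in `Sing T ⊆` closed fibre, and it is not the zero ideal because its
cosupport misses the regular point). [cite: Temkin2008, Def. 2.2.6 (i)] -/
theorem atomConclusion_of_admitsDesingularization {S : Type u} [CommRing S] [IsLocalRing S]
    {T : Scheme.{u}} (f : T ⟶ Spec (.of S))
    (hoff : ∀ t : T, f.base t ≠ IsLocalRing.closedPoint S →
      IsRegularLocalRing (T.presheaf.stalk t))
    (hreg : (Scheme.regularLocus T).Nonempty) (hdes : Scheme.AdmitsDesingularization T) :
    ∃ (J : T.IdealSheafData) (T' : Scheme.{u}) (π : T' ⟶ T), J ≠ ⊥ ∧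
      (∀ t : T, t ∈ J.support → f.base t = IsLocalRing.closedPoint S) ∧
      IsBlowup π J ∧ Scheme.IsRegular T' := by
  obtain ⟨T', π, ⟨J, hπ, hJ⟩, hT'⟩ := hdes
  refine ⟨J, T', π, ?_, ?_, hπ, hT'⟩
  · rintro rfl
    obtain ⟨t, ht⟩ := hreg
    have hmem : t ∈ ((⊥ : T.IdealSheafData).support : Set T) := by
      rw [Scheme.IdealSheafData.support_bot]; trivial
    exact hJ hmem ht
  · intro t ht
    by_contra hne
    exact hJ ht (hoff t hne)

/-- **W1 — the registered atom's conclusion for ONE `T` from `Scheme.AdmitsDesingularization T`.**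
For `T` integral over a local base `Spec S`, regular off the closed fibre (the hypotheses of
`stub_atomDimFour` that matter here; completeness, regularity, dimension and residue field of
`S`, properness and birationality of `f` are not used), a Temkin desingularization of `T` — one
blowing up with centre in `Sing T` and regular source, the format of Cossart–Jannsen–Saito 2020
Thm. 1.2 — yields the atom's conclusion. [cite: Temkin2008, Def. 2.2.6 (i)] -/
theorem atomDimFour_of_admitsDesingularization {S : Type u} [CommRing S] [IsLocalRing S]
    (T : Scheme.{u}) (f : T ⟶ Spec (.of S)) [IsIntegral T]
    (hoff : ∀ t : T, f.base t ≠ IsLocalRing.closedPoint S →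
      IsRegularLocalRing (T.presheaf.stalk t))
    (hdes : Scheme.AdmitsDesingularization T) :
    ∃ (J : T.IdealSheafData) (T' : Scheme.{u}) (π : T' ⟶ T), J ≠ ⊥ ∧
      (∀ t : T, t ∈ J.support → f.base t = IsLocalRing.closedPoint S) ∧
      IsBlowup π J ∧ Scheme.IsRegular T' :=
  atomConclusion_of_admitsDesingularization f hoff
    ⟨_, Literature.AlgebraicGeometry.Resolution.genericPoint_mem_regularLocus T⟩ hdes

/-- **W1 — the same from a CJS-style SEQUENCE**: a finite sequence of blowing ups of `T` in
centres inside the successive singular loci, ending in a regular scheme, gives the atom's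
conclusion (`T` Noetherian, integral, regular off the closed fibre), via the collapse
`admitsDesingularization_of_isSingularBlowupSequence` (Stacks 080B).
[cite: CossartJannsenSaito2020, Thm. 1.2 (format)] [cite: Temkin2008, Lemma 2.1.4] -/
theorem atomDimFour_of_isSingularBlowupSequence {S : Type u} [CommRing S] [IsLocalRing S]
    (T : Scheme.{u}) (f : T ⟶ Spec (.of S)) [IsIntegral T] [IsNoetherian T]
    (hoff : ∀ t : T, f.base t ≠ IsLocalRing.closedPoint S →
      IsRegularLocalRing (T.presheaf.stalk t))
    {T' : Scheme.{u}} {π : T' ⟶ T} (hseq : IsSingularBlowupSequence π)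
    (hreg : Scheme.IsRegular T') :
    ∃ (J : T.IdealSheafData) (T' : Scheme.{u}) (π : T' ⟶ T), J ≠ ⊥ ∧
      (∀ t : T, t ∈ J.support → f.base t = IsLocalRing.closedPoint S) ∧
      IsBlowup π J ∧ Scheme.IsRegular T' :=
  atomDimFour_of_admitsDesingularization T f hoff
    (admitsDesingularization_of_isSingularBlowupSequence hseq hreg)

/-- **W1 — the atom hypothesis `hA4` of p171172 from "CJS Thm 1.2-format desingularization of
sandwiched fourfold germs at perfect closed points"** (the planner's
`AdmitsDesingSandwichedFourPerfect`, written UNFOLDED in tree vocabulary): for every prime `p`,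
if every integral `T`, proper and birational over a complete regular local `S` of dimension `4`
and characteristic `p` with perfect residue field and regular off the closed fibre, admits a
Temkin desingularization, then the dimension-EXACTLY-4 atom holds at `p` in the exact shape consumed by
`Theorems.patchingRelPerfect_of_printed_of_atomDimFour_of_dimGeFive`. The hypothesis is OPEN
(Cossart–Piltant one dimension up); nothing is claimed about it.
[cite: Temkin2008, Def. 2.2.6 (i)] [cite: CossartPiltant2019, arXiv v1 p. 58 §5] -/
theorem atomDimFour_of_admitsDesingSandwichedFourPerfect
    (hD : ∀ (p : ℕ), p.Prime → ∀ (S : Type) [CommRing S] [IsRegularLocalRing S] [CharP S p]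
      [IsAdicComplete (IsLocalRing.maximalIdeal S) S]
      [PerfectField (IsLocalRing.ResidueField S)], ringKrullDim S = (4 : ℕ) →
      ∀ (T : Scheme.{0}) (f : T ⟶ Spec (.of S)), IsIntegral T → IsProper f → IsBirational f →
        (∀ t : T, f.base t ≠ IsLocalRing.closedPoint S → IsRegularLocalRing (T.presheaf.stalk t)) →
        Scheme.AdmitsDesingularization T) :
    ∀ (p : ℕ), p.Prime → ∀ (S : Type) [CommRing S] [IsRegularLocalRing S] [CharP S p]
      [IsAdicComplete (IsLocalRing.maximalIdeal S) S]
      [PerfectField (IsLocalRing.ResidueField S)], ringKrullDim S = (4 : ℕ) →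
      ∀ (T : Scheme.{0}) (f : T ⟶ Spec (.of S)), IsIntegral T → IsProper f → IsBirational f →
        (∀ t : T, f.base t ≠ IsLocalRing.closedPoint S → IsRegularLocalRing (T.presheaf.stalk t)) →
        ∃ (J : T.IdealSheafData) (T' : Scheme.{0}) (π : T' ⟶ T), J ≠ ⊥ ∧
          (∀ t : T, t ∈ J.support → f.base t = IsLocalRing.closedPoint S) ∧
          IsBlowup π J ∧ Scheme.IsRegular T' :=
  fun p hp S _ _ _ _ _ hdim T f hT hf hbir hoff =>
    @atomDimFour_of_admitsDesingularization S _ _ T f hT hoff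
      (hD p hp S hdim T f hT hf hbir hoff)

/-- **The crux `FrobeniusClosing.PatchingRelPerfect` BY NAME from: the printed dimension-`≤ 3`
theorems (Cossart–Piltant 2019 Thm. 1.1 and Prop. 4.4; Cossart–Jannsen–Saito 2020 Thm. 1.2 in
single-blow-up format), "every sandwiched fourfold germ at a perfect closed point — `T` integral,
proper and birational over a complete regular local `S` of dimension `4`, characteristic `p`,
perfect residue field, regular off the closed fibre — ADMITS A DESINGULARIZATION in Temkin's
sense" (OPEN), and the dimension-`≥ 5` residual.** Sharpens p171751's reduction (no Axiom 4 /
principalization on regular fourfolds). CONDITIONAL; the item stays open.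
[cite: CossartPiltant2019, Thm. 1.1 and Prop. 4.4] [cite: CossartJannsenSaito2020, Thm. 1.2]
[cite: Temkin2008, Def. 2.2.6, Prop. 2.3.4] [cite: Piltant2013, p. 2] -/
theorem patchingRelPerfect_of_printed_of_admitsDesingFour_of_dimGeFive
    (hG : CossartPiltant2019General.{0}) (hP : CossartPiltant2019Principalization.{0})
    (hCJS : ∀ (X : Scheme.{0}) [IsNoetherian X] [IsReduced X], Scheme.IsExcellent X →
      topologicalKrullDim X ≤ 2 → Scheme.AdmitsDesingularization X)
    (hD : ∀ (p : ℕ), p.Prime → ∀ (S : Type) [CommRing S] [IsRegularLocalRing S] [CharP S p]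
      [IsAdicComplete (IsLocalRing.maximalIdeal S) S]
      [PerfectField (IsLocalRing.ResidueField S)], ringKrullDim S = (4 : ℕ) →
      ∀ (T : Scheme.{0}) (f : T ⟶ Spec (.of S)), IsIntegral T → IsProper f → IsBirational f →
        (∀ t : T, f.base t ≠ IsLocalRing.closedPoint S → IsRegularLocalRing (T.presheaf.stalk t)) →
        Scheme.AdmitsDesingularization T)
    (h5 : ∀ (p : ℕ), p.Prime →
      (∀ (k K : Type) [Field k] [CharP k p] [PerfectField k] [Field K] [Algebra k K],
        (⊤ : IntermediateField k K).FG → ∀ O : ValuationSubring K, (∀ c : k, algebraMap k K c ∈ O) →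
          ∀ R : Subalgebra k K, R.FG → R.toSubring ≤ O.toSubring →
            ∃ (A : Subalgebra k K) (h : A.toSubring ≤ O.toSubring), R ≤ A ∧ A.FG ∧
              IsFractionRing A K ∧ IsRegularLocalRing (Localization.AtPrime
                (Ideal.comap (Subring.inclusion h) (IsLocalRing.maximalIdeal O)))) →
      ∀ (k : Type) [Field k] [CharP k p] [PerfectField k] (X : Scheme.{0}) (f : X ⟶ Spec (.of k)),
        IsSeparated f → LocallyOfFiniteType f → QuasiCompact f → IsIntegral X →
        ¬ topologicalKrullDim X ≤ 4 → Scheme.HasResolution X) :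
    Summit.ResolutionOfSingularities.ResolutionOfSingularities.Theses.FrobeniusClosing.PatchingRelPerfect :=
  patchingRelPerfect_of_printed_of_atomDimFour_of_dimGeFive hG hP hCJS
    (atomDimFour_of_admitsDesingSandwichedFourPerfect hD) h5

/-- The same certificate with the CJS conjunct taken from the NAMED FACT
`CossartJannsenSaito2020Sequence` (de-vendored by
`cjs2020BlowupFormat_of_cossartJannsenSaito2020Sequence`): the crux BY NAME from three named
facts of the tree, the open desingularization statement for sandwiched fourfold germs at perfect
closed points, and the dimension-`≥ 5` residual. CONDITIONAL.
[cite: CossartPiltant2019, Thm. 1.1 and Prop. 4.4] [cite: CossartJannsenSaito2020, Thm. 1.2] -/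
theorem patchingRelPerfect_of_namedFacts_of_admitsDesingFour_of_dimGeFive
    (hG : CossartPiltant2019General.{0}) (hP : CossartPiltant2019Principalization.{0})
    (hS : CossartJannsenSaito2020Sequence.{0})
    (hD : ∀ (p : ℕ), p.Prime → ∀ (S : Type) [CommRing S] [IsRegularLocalRing S] [CharP S p]
      [IsAdicComplete (IsLocalRing.maximalIdeal S) S]
      [PerfectField (IsLocalRing.ResidueField S)], ringKrullDim S = (4 : ℕ) →
      ∀ (T : Scheme.{0}) (f : T ⟶ Spec (.of S)), IsIntegral T → IsProper f → IsBirational f →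
        (∀ t : T, f.base t ≠ IsLocalRing.closedPoint S → IsRegularLocalRing (T.presheaf.stalk t)) →
        Scheme.AdmitsDesingularization T)
    (h5 : ∀ (p : ℕ), p.Prime →
      (∀ (k K : Type) [Field k] [CharP k p] [PerfectField k] [Field K] [Algebra k K],
        (⊤ : IntermediateField k K).FG → ∀ O : ValuationSubring K, (∀ c : k, algebraMap k K c ∈ O) →
          ∀ R : Subalgebra k K, R.FG → R.toSubring ≤ O.toSubring →
            ∃ (A : Subalgebra k K) (h : A.toSubring ≤ O.toSubring), R ≤ A ∧ A.FG ∧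
              IsFractionRing A K ∧ IsRegularLocalRing (Localization.AtPrime
                (Ideal.comap (Subring.inclusion h) (IsLocalRing.maximalIdeal O)))) →
      ∀ (k : Type) [Field k] [CharP k p] [PerfectField k] (X : Scheme.{0}) (f : X ⟶ Spec (.of k)),
        IsSeparated f → LocallyOfFiniteType f → QuasiCompact f → IsIntegral X →
        ¬ topologicalKrullDim X ≤ 4 → Scheme.HasResolution X) :
    Summit.ResolutionOfSingularities.ResolutionOfSingularities.Theses.FrobeniusClosing.PatchingRelPerfect :=
  patchingRelPerfect_of_printed_of_admitsDesingFour_of_dimGeFive hG hP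
    (cjs2020BlowupFormat_of_cossartJannsenSaito2020Sequence hS) hD h5

end Summit.ResolutionOfSingularities.ResolutionOfSingularities.Theorems

end
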